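import Literature.Analysis.FluidPDE.SpaceTimeCalculus
import HarnessLib

/-!
# The pressure Poisson equation of a classical Navier–Stokes solution (Tao 2011, (8))

Analysis/FluidPDE support file for the discharge of the named fact
`Literature.Analysis.FluidPDE.tao2011_pressurePoisson` (`FluidPDE/NormalisedPressureProofs`, input F0 of Tao's
pressure-normalisation lemma, Tao 2011 Lemma 4.1 (i)).

Let `E` be a finite-dimensional real inner product space and `(u, p)` a classical solution of
the forced Navier–Stokes system on a time set `S` (`Fluid.IsClassicalNSSolutionOn S ν f u p`:
jointly `C^∞`, `∂ₜu + (u·∇)u = νΔu − ∇p + f`, `div u = 0`). Taking the divergence of the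
momentum equation and using incompressibility gives, at every **interior** time `t` of `S`
(where the one-sided time derivative is the two-sided one and Schwarz's theorem applies in
`(t, x)`),

  `Δ p(t) = -div((u·∇)u)(t) + div f(t)`     (Tao 2011, (8): `Δp = -∂ᵢ∂ⱼ(uᵢuⱼ) + ∇·f`),

because `div ∂ₜu = ∂ₜ div u = 0`, `div Δu = Δ div u = 0` and `div ∇p = Δp`.

## Main statements

* `Literature.Analysis.FluidPDE.divergence_gradient`: `div ∇g = Δg` for `g ∈ C²`.
* `Literature.Analysis.FluidPDE.divergence_laplacian_eq_zero`: `div Δv = 0` for a divergence-free `v ∈ C³`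
  (symmetry of third derivatives, from Mathlib's `ContDiffAt.isSymmSndFDerivAt` applied to `v`
  and to `Dv`).
* `Literature.Analysis.FluidPDE.divergence_deriv_time_eq_zero`: `div ∂ₜu = 0` for a divergence-free field jointly
  smooth on an open time set (exchange of `∂ₜ` and `D`, `SpaceTimeCalculus`).
* `Literature.Analysis.FluidPDE.laplacian_pressure_eq_of_isClassicalNSSolutionOn`: the pressure Poisson equation at
  interior times.

## References

* T. Tao, *Localisation and compactness properties of the Navier–Stokes global regularity
  problem*, Anal. PDE 6 (2013) 25–107 = arXiv:1108.1165, (8) p. 4.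
* A. J. Majda, A. L. Bertozzi, *Vorticity and Incompressible Flow* (CUP 2002), §1.2, (1.13)
  (the pressure Poisson equation).
-/

noncomputable section

open Set Function Filter Topology InnerProductSpace
open scoped RealInnerProductSpace Laplacian ContDiff

namespace Literature.Analysis.FluidPDE

variable {E : Type*} [NormedAddCommGroup E] [InnerProductSpace ℝ E] [FiniteDimensional ℝ E]
variable {F : Type*} [NormedAddCommGroup F] [NormedSpace ℝ F]

/-! ### Algebra of the pointwise divergence -/

omit [FiniteDimensional ℝ E] in
/-- `div (v + w) = div v + div w` at points of differentiability. [folklore] -/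
theorem divergence_add_apply {v w : E → E} {x : E} (hv : DifferentiableAt ℝ v x)
    (hw : DifferentiableAt ℝ w x) :
    VectorCalculus.divergence (fun y => v y + w y) x = VectorCalculus.divergence v x + VectorCalculus.divergence w x := by
  simp only [VectorCalculus.divergence, fderiv_fun_add hv hw, ContinuousLinearMap.toLinearMap_add, map_add]

omit [FiniteDimensional ℝ E] in
/-- `div (v - w) = div v - div w` at points of differentiability. [folklore] -/
theorem divergence_sub_apply {v w : E → E} {x : E} (hv : DifferentiableAt ℝ v x)
    (hw : DifferentiableAt ℝ w x) :
    VectorCalculus.divergence (fun y => v y - w y) x = VectorCalculus.divergence v x - VectorCalculus.divergence w x := by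
  simp only [VectorCalculus.divergence, fderiv_fun_sub hv hw, ContinuousLinearMap.toLinearMap_sub, map_sub]

omit [FiniteDimensional ℝ E] in
/-- `div (c • v) = c div v` at points of differentiability. [folklore] -/
theorem divergence_const_smul_apply {v : E → E} {x : E} (hv : DifferentiableAt ℝ v x) (c : ℝ) :
    VectorCalculus.divergence (fun y => c • v y) x = c * VectorCalculus.divergence v x := by
  simp only [VectorCalculus.divergence, fderiv_fun_const_smul hv c, ContinuousLinearMap.toLinearMap_smul, map_smul,
    smul_eq_mul]

omit [FiniteDimensional ℝ E] in
/-- Evaluating the derivative of an operator-valued map at a fixed vector commutes with `fderiv`: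
`D(y ↦ G(y) c)(x) a = DG(x) a c`. [folklore] -/
theorem fderiv_apply_const_apply {G : E → E →L[ℝ] F} {x : E} (hG : DifferentiableAt ℝ G x)
    (c a : E) : fderiv ℝ (fun y => G y c) x a = fderiv ℝ G x a c := by
  rw [fderiv_clm_apply hG (differentiableAt_const c)]
  simp

omit [FiniteDimensional ℝ E] in
/-- The derivative of a coordinate divergence sum `y ↦ Σⱼ ⟪bⱼ, G(y) bⱼ⟫` along `a` is
`Σⱼ ⟪bⱼ, DG(x) a bⱼ⟫`. [folklore] -/
theorem fderiv_sum_inner_apply_apply {ι : Type*} [Fintype ι] (b : OrthonormalBasis ι ℝ E)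
    {G : E → E →L[ℝ] E} {x : E} (hG : DifferentiableAt ℝ G x) (a : E) :
    fderiv ℝ (fun y => ∑ j, ⟪b j, G y (b j)⟫) x a = ∑ j, ⟪b j, fderiv ℝ G x a (b j)⟫ := by
  have hd : ∀ j, DifferentiableAt ℝ (fun y => G y (b j)) x := fun j =>
    hG.clm_apply (differentiableAt_const _)
  rw [fderiv_fun_sum fun j _ => (differentiableAt_const _).inner ℝ (hd j),
    _root_.FunLike.coe_sum, Finset.sum_apply]
  refine Finset.sum_congr rfl fun j _ => ?_
  rw [fderiv_inner_apply ℝ (differentiableAt_const _) (hd j), fderiv_apply_const_apply hG,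
    fderiv_fun_const]
  simp

/-! ### `div ∇ = Δ` -/

/-- **`div ∇g = Δg`** for `g ∈ C²(E)`. [folklore] -/
theorem divergence_gradient {g : E → ℝ} (hg : ContDiff ℝ 2 g) (x : E) :
    VectorCalculus.divergence (gradient g) x = (Δ g) x := by
  set b := stdOrthonormalBasis ℝ E
  have hg1 : ContDiff ℝ 1 (fderiv ℝ g) := hg.fderiv_right (m := 1) le_rfl
  have hgrad : ContDiff ℝ 1 (gradient g) :=
    (InnerProductSpace.toDual ℝ E).symm.contDiff.comp hg1
  have hgd : DifferentiableAt ℝ (gradient g) x := hgrad.differentiable one_ne_zero x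
  rw [divergence_eq_sum_inner_fderiv b, laplacian_eq_iteratedFDeriv_orthonormalBasis g b]
  refine Finset.sum_congr rfl fun i _ => ?_
  have h1 : ⟪b i, fderiv ℝ (gradient g) x (b i)⟫ =
      fderiv ℝ (fun y => ⟪b i, gradient g y⟫) x (b i) := by
    rw [fderiv_inner_apply ℝ (differentiableAt_const _) hgd, fderiv_fun_const]
    simp
  have h2 : (fun y => ⟪b i, gradient g y⟫) = fun y => fderiv ℝ g y (b i) := by
    funext y
    rw [gradient, real_inner_comm, InnerProductSpace.toDual_symm_apply]
  rw [h1, h2, fderiv_fderiv_apply_const hg]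

/-! ### `div Δ v = 0` for divergence-free `v` -/

/-- **`div Δv = 0` for a divergence-free `v ∈ C³(E; E)`.** With `D³v` symmetric (Schwarz for
`v` and for `Dv`), `div Δv = Σⱼ Σᵢ ⟪bⱼ, D³v(bⱼ, bᵢ, bᵢ)⟫ = Σᵢ ∂ᵢ∂ᵢ (div v) = 0`. [folklore] -/
theorem divergence_laplacian_eq_zero {v : E → E} (hv : ContDiff ℝ 3 v) (hdiv : VectorCalculus.IsDivFree v)
    (x : E) : VectorCalculus.divergence (Δ v) x = 0 := by
  set b := stdOrthonormalBasis ℝ E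
  set D1 : E → E →L[ℝ] E := fderiv ℝ v with hD1_def
  set D2 : E → E →L[ℝ] E →L[ℝ] E := fderiv ℝ D1 with hD2_def
  set D3 : E → E →L[ℝ] E →L[ℝ] E →L[ℝ] E := fderiv ℝ D2 with hD3_def
  have hD1 : ContDiff ℝ 2 D1 := hv.fderiv_right (m := 2) le_rfl
  have hD2 : ContDiff ℝ 1 D2 := hD1.fderiv_right (m := 1) le_rfl
  have hD1d : Differentiable ℝ D1 := hD1.differentiable two_ne_zero
  have hD2d : Differentiable ℝ D2 := hD2.differentiable one_ne_zero
  -- Schwarz for `v` (everywhere) and for `Dv` (at `x`)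
  have h23 : minSmoothness ℝ 2 ≤ (3 : ℕ∞ω) := by
    rw [minSmoothness_of_isRCLikeNormedField]
    exact_mod_cast (show (2 : ℕ) ≤ 3 by norm_num)
  have h22 : minSmoothness ℝ 2 ≤ (2 : ℕ∞ω) := by
    rw [minSmoothness_of_isRCLikeNormedField]
  have hS2 : ∀ y a c, D2 y a c = D2 y c a := fun y a c =>
    (hv.contDiffAt.isSymmSndFDerivAt h23).eq a c
  have hS3 : ∀ a c, D3 x a c = D3 x c a := fun a c =>
    (hD1.contDiffAt.isSymmSndFDerivAt h22).eq a c
  have hS3' : ∀ a c d, D3 x a c d = D3 x a d c := fun a c d => by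
    have h1 : (fun y => D2 y c d) = fun y => D2 y d c := funext fun y => hS2 y c d
    have h2 : ∀ c d, fderiv ℝ (fun y => D2 y c d) x a = D3 x a c d := fun c d => by
      have hcd : DifferentiableAt ℝ (fun y => D2 y c) x := (hD2d x).clm_apply
        (differentiableAt_const _)
      rw [fderiv_apply_const_apply hcd, fderiv_apply_const_apply (hD2d x)]
    rw [← h2 c d, h1, h2 d c]
  -- `Δ v = Σᵢ D²v(·)(bᵢ, bᵢ)` and its derivative
  have hΔ : (Δ v) = fun y => ∑ i, D2 y (b i) (b i) := by
    funext y
    rw [laplacian_eq_sum_fderiv_fderiv b (hv.of_le (by norm_num)) y]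
    exact Finset.sum_congr rfl fun i _ => fderiv_apply_const_apply (hD1d y) _ _
  have hfd : ∀ a, fderiv ℝ (Δ v) x a = ∑ i, D3 x a (b i) (b i) := fun a => by
    have hdi : ∀ i, DifferentiableAt ℝ (fun y => D2 y (b i)) x := fun i =>
      (hD2d x).clm_apply (differentiableAt_const _)
    rw [hΔ, fderiv_fun_sum fun i _ => (hdi i).clm_apply (differentiableAt_const _),
      _root_.FunLike.coe_sum, Finset.sum_apply]
    refine Finset.sum_congr rfl fun i _ => ?_
    rw [fderiv_apply_const_apply (hdi i), fderiv_apply_const_apply (hD2d x)]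
  -- twice-differentiated incompressibility: `Σⱼ ⟪bⱼ, D³v(a, a, bⱼ)⟫ = 0`
  have hdiv1 : (fun y => ∑ j, ⟪b j, D1 y (b j)⟫) = fun _ => (0 : ℝ) := by
    funext y
    rw [← divergence_eq_sum_inner_fderiv b v y]
    exact hdiv y
  have hdiv2 : ∀ a, (fun y => ∑ j, ⟪b j, D2 y a (b j)⟫) = fun _ => (0 : ℝ) := fun a => by
    funext y
    rw [← fderiv_sum_inner_apply_apply b (hD1d y) a, hdiv1]
    simp
  have hdiv3 : ∀ a, ∑ j, ⟪b j, D3 x a a (b j)⟫ = 0 := fun a => by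
    have hda : DifferentiableAt ℝ (fun y => D2 y a) x := (hD2d x).clm_apply
      (differentiableAt_const _)
    have := fderiv_sum_inner_apply_apply b hda a
    rw [hdiv2 a, fderiv_apply_const_apply (hD2d x)] at this
    simpa using this.symm
  -- assemble
  rw [divergence_eq_sum_inner_fderiv b]
  simp_rw [hfd, inner_sum]
  rw [Finset.sum_comm]
  refine Finset.sum_eq_zero fun i _ => ?_
  have : ∀ j, D3 x (b j) (b i) (b i) = D3 x (b i) (b i) (b j) := fun j => by
    rw [hS3 (b j) (b i)]
    exact hS3' _ _ _
  simp_rw [this]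
  exact hdiv3 (b i)

/-- The Laplacian of a `C³` field is differentiable. [folklore] -/
theorem differentiable_laplacian {F' : Type*} [NormedAddCommGroup F'] [InnerProductSpace ℝ F']
    {v : E → F'} (hv : ContDiff ℝ 3 v) : Differentiable ℝ (Δ v) := by
  set b := stdOrthonormalBasis ℝ E
  have hD1 : ContDiff ℝ 2 (fderiv ℝ v) := hv.fderiv_right (m := 2) le_rfl
  have hD2d : Differentiable ℝ (fderiv ℝ (fderiv ℝ v)) :=
    (hD1.fderiv_right (m := 1) le_rfl).differentiable one_ne_zero
  have hΔ : (Δ v) = fun y => ∑ i, fderiv ℝ (fderiv ℝ v) y (b i) (b i) := by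
    funext y
    rw [laplacian_eq_sum_fderiv_fderiv b (hv.of_le (by norm_num)) y]
    exact Finset.sum_congr rfl fun i _ =>
      fderiv_apply_const_apply (hD1.differentiable two_ne_zero y) _ _
  rw [hΔ]
  exact Differentiable.fun_sum fun i _ =>
    (hD2d.clm_apply (differentiable_const _)).clm_apply (differentiable_const _)

/-! ### `div ∂ₜ u = 0` for divergence-free `u` -/

/-- **`div ∂ₜu = ∂ₜ div u = 0`.** For a field `u` jointly smooth on an open time set `S` with
`div u(s) = 0` for `s ∈ S`, the two-sided time derivative `y ↦ ∂ₜu(t, y)` is divergence free at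
every `t ∈ S` (exchange of `∂ₜ` and `D`, `IsSmoothSpaceTimeOn.hasDerivAt_fderiv_slice_clm`). [folklore] -/
theorem divergence_deriv_time_eq_zero {S : Set ℝ} {u : ℝ → E → E} (hu : IsSmoothSpaceTimeOn S u)
    (hS : IsOpen S) (hdiv : ∀ s ∈ S, VectorCalculus.IsDivFree (u s)) {t : ℝ} (ht : t ∈ S) (x : E) :
    VectorCalculus.divergence (fun y => deriv (fun s => u s y) t) x = 0 := by
  set b := stdOrthonormalBasis ℝ E
  set Φ' := fderiv ℝ (fun y => deriv (fun s => u s y) t) x with hΦ'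
  have hΦ : HasDerivAt (fun s => fderiv ℝ (u s) x) Φ' t := hu.hasDerivAt_fderiv_slice_clm hS ht x
  -- the time line of `div u(·)(x)` and its derivative
  have hj : ∀ j, HasDerivAt (fun s => ⟪b j, fderiv ℝ (u s) x (b j)⟫) ⟪b j, Φ' (b j)⟫ t := by
    intro j
    have h1 : HasDerivAt (fun s => fderiv ℝ (u s) x (b j)) (Φ' (b j)) t := by
      simpa using hΦ.clm_apply (hasDerivAt_const t (b j))
    simpa using (hasDerivAt_const t (b j)).inner ℝ h1
  have hsum : HasDerivAt (fun s => ∑ j, ⟪b j, fderiv ℝ (u s) x (b j)⟫) (∑ j, ⟪b j, Φ' (b j)⟫) t :=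
    HasDerivAt.fun_sum fun j _ => hj j
  -- it vanishes identically near `t`
  have hzero : (fun s => ∑ j, ⟪b j, fderiv ℝ (u s) x (b j)⟫) =ᶠ[𝓝 t] fun _ => (0 : ℝ) := by
    filter_upwards [hS.mem_nhds ht] with s hs
    rw [← divergence_eq_sum_inner_fderiv b (u s) x]
    exact hdiv s hs x
  have h0 : HasDerivAt (fun _ : ℝ => (0 : ℝ)) (∑ j, ⟪b j, Φ' (b j)⟫) t :=
    hsum.congr_of_eventuallyEq hzero.symm
  rw [divergence_eq_sum_inner_fderiv b]
  exact (h0.unique (hasDerivAt_const t 0))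

end Literature.Analysis.FluidPDE

namespace Literature.Analysis.FluidPDE

variable {E : Type*} [NormedAddCommGroup E] [InnerProductSpace ℝ E] [FiniteDimensional ℝ E]

/-- **The pressure Poisson equation (Tao 2011, (8)).** For a classical solution
`Fluid.IsClassicalNSSolutionOn S ν f u p` and an interior time `t` of `S`,
`Δ p(t)(x) = -div((u(t)·∇)u(t))(x) + div f(t)(x)` for every `x`: take the divergence of the
momentum equation on the open set `interior S` (where `timeDerivWithin = ∂ₜ`) and use
`div ∂ₜu = 0`, `div Δu = 0` (incompressibility) and `div ∇p = Δp`. Any viscosity `ν`. [cite: Tao2011, (8)] -/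
theorem laplacian_pressure_eq_of_isClassicalNSSolutionOn {S : Set ℝ} {ν : ℝ} {f u : ℝ → E → E}
    {p : ℝ → E → ℝ} (h : FluidPDE.IsClassicalNSSolutionOn S ν f u p) {t : ℝ} (ht : t ∈ interior S)
    (x : E) :
    Δ (p t) x = -VectorCalculus.divergence (FluidPDE.convect (u t) (u t)) x + VectorCalculus.divergence (f t) x := by
  -- restrict to the open set of interior times
  set S₀ := interior S with hS₀_def
  have hS₀ : IsOpen S₀ := isOpen_interior
  have h₀ : FluidPDE.IsClassicalNSSolutionOn S₀ ν f u p := h.mono interior_subset hS₀.uniqueDiffOn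
  -- the two-sided time derivative and the regularity of all fields at time `t`
  set w : E → E := fun y => deriv (fun s => u s y) t with hw_def
  have hw : ContDiff ℝ ∞ w := (h₀.smooth_velocity.isSmoothSpaceTimeOn_deriv hS₀).contDiff_slice ht
  have hu : ContDiff ℝ ∞ (u t) := h₀.contDiff_velocity ht
  have hp : ContDiff ℝ ∞ (p t) := h₀.contDiff_pressure ht
  have hf : ContDiff ℝ ∞ (f t) := (h₀.isSmoothSpaceTimeOn_force hS₀.uniqueDiffOn).contDiff_slice ht
  have hu3 : ContDiff ℝ 3 (u t) := contDiff_infty.1 hu 3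
  have hp2 : ContDiff ℝ 2 (p t) := contDiff_infty.1 hp 2
  have hwd : Differentiable ℝ w := (contDiff_infty.1 hw 1).differentiable one_ne_zero
  have hfd : Differentiable ℝ (f t) := (contDiff_infty.1 hf 1).differentiable one_ne_zero
  have hud : Differentiable ℝ (u t) := (contDiff_infty.1 hu 1).differentiable one_ne_zero
  have hDud : Differentiable ℝ (fderiv ℝ (u t)) :=
    ((contDiff_infty.1 hu 2).fderiv_right (m := 1) le_rfl).differentiable one_ne_zero
  have hΔd : Differentiable ℝ (Δ (u t)) := FluidPDE.differentiable_laplacian hu3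
  have hcd : Differentiable ℝ (FluidPDE.convect (u t) (u t)) := by
    have : FluidPDE.convect (u t) (u t) = fun y => fderiv ℝ (u t) y (u t y) := rfl
    rw [this]
    exact hDud.clm_apply hud
  -- the momentum equation solved for the pressure gradient
  have hgrad : gradient (p t) = fun y =>
      ν • (Δ (u t)) y + f t y - w y - FluidPDE.convect (u t) (u t) y := by
    funext y
    have hm := h₀.momentum t ht y
    rw [FluidPDE.timeDerivWithin_eq_deriv hS₀ ht] at hm
    change w y + FluidPDE.convect (u t) (u t) y = ν • (Δ (u t)) y - gradient (p t) y + f t y at hm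
    rw [← sub_eq_zero] at hm ⊢
    rw [← hm]
    abel
  -- take the divergence
  have hdivw : VectorCalculus.divergence w x = 0 :=
    FluidPDE.divergence_deriv_time_eq_zero h₀.smooth_velocity hS₀ h₀.divFree ht x
  have hdivΔ : VectorCalculus.divergence (Δ (u t)) x = 0 :=
    FluidPDE.divergence_laplacian_eq_zero hu3 (h₀.divFree t ht) x
  have d1 : DifferentiableAt ℝ (fun y => ν • (Δ (u t)) y) x := (hΔd x).const_smul ν
  have d2 : DifferentiableAt ℝ (fun y => ν • (Δ (u t)) y + f t y) x := d1.add (hfd x)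
  have d3 : DifferentiableAt ℝ (fun y => ν • (Δ (u t)) y + f t y - w y) x := d2.sub (hwd x)
  rw [← FluidPDE.divergence_gradient hp2, hgrad, FluidPDE.divergence_sub_apply d3 (hcd x),
    FluidPDE.divergence_sub_apply d2 (hwd x), FluidPDE.divergence_add_apply d1 (hfd x),
    FluidPDE.divergence_const_smul_apply (hΔd x), hdivw, hdivΔ]
  ring

end Literature.Analysis.FluidPDE

end
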